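import Summits.Ventures.DiscreteObjects.UnitDistance.GeometricFractionalAveraging
import Summits.Ventures.DiscreteObjects.UnitDistance.Sqrt3TripleReduction
import Summits.Ventures.DiscreteObjects.UnitDistance.PlaneLowerBoundFive
import HarnessLib

/-!
# The averaging lemma for field planes: `K`-rational direct isometries as the Følner family (cell `pub-namedobj`, target (U), seat udg g24)

Framing (verbatim for the cell): lottery ticket; floor = certified bounds/negative ranges.

`GeometricFractionalAveraging.lean` proves the abstract averaging lemma `not_colorable_of_geometric_certificate` for an arbitrary graph and an
arbitrary finite family of adjacency-preserving self-maps.  This file specialises it to the object of the cell's LP line: the unit-distance graph of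
`K²` for a real field `K` (complex model `pointsK K ⊂ ℂ` of `Sqrt3TripleReduction.lean`), with the self-maps the `K`-RATIONAL DIRECT ISOMETRIES
`w ↦ x + u (w − p)` (`simil` of `PlaneLowerBoundFive.lean`; `x, u, p ∈ pointsK K`, `‖u‖ = 1`), which preserve `pointsK K` (`simil_memK`) and unit
distances.  `planeKGraph K` is the unit-distance graph on the subtype `pointsK K`; `planeKHom` maps it into `planeUnitDistanceGraph.induce (fieldPoints K)`
through the isometry `eC`, so a certificate excluding `k`-colourings of `planeKGraph K` excludes them for the plane over `K`
(`not_colorable_plane_of_geometric_certificate`).  A concrete certificate must still supply the Følner datum (indices `σ`, exceptional sets `E`,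
and the point-set identities `htrans`) — elementary once the LP certificate of FARM-ASK-U24 #1 exists.  Ours; nothing here is a cited fact.
-/

noncomputable section

namespace Summit.Ventures.DiscreteObjects.UnitDistance

open Complex SimpleGraph IntermediateField Sqrt3Triple Finset
open scoped Classical

variable {K : IntermediateField ℚ ℝ}

/-- `K`-rational direct isometries preserve the `K`-points of `ℂ`. -/
theorem simil_memK {x u p w : ℂ} (hx : x ∈ pointsK K) (hu : u ∈ pointsK K) (hp : p ∈ pointsK K) (hw : w ∈ pointsK K) :
    simil x u p w ∈ pointsK K := by
  unfold simil
  exact memK_add hx (memK_mul hu (memK_sub hw hp))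

variable (K) in
/-- The unit-distance graph on the `K`-points of the complex plane. -/
def planeKGraph : SimpleGraph (pointsK K) where
  Adj z w := ‖(z : ℂ) - w‖ = 1
  symm := ⟨fun z w h => by rw [norm_sub_rev]; exact h⟩
  loopless := ⟨fun z h => by simp at h⟩

variable (K) in
/-- The complex model maps into the plane model: `z ↦ eC z`. -/
def planeKHom : planeKGraph K →g planeUnitDistanceGraph.induce (fieldPoints K) where
  toFun z := ⟨eC z, eC_mem z.2⟩
  map_rel' := by
    intro z w h
    change dist (eC (z : ℂ)) (eC (w : ℂ)) = 1
    rw [dist_eC]; exact h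

/-- A `K`-rational direct isometry as a self-map of `pointsK K`. -/
def similK (x u p : pointsK K) (w : pointsK K) : pointsK K :=
  ⟨simil x u p w, simil_memK x.2 u.2 p.2 w.2⟩

/-- With `‖u‖ = 1` it preserves adjacency. -/
theorem similK_adj {x u p : pointsK K} (hu : ‖(u : ℂ)‖ = 1) {a b : pointsK K} (h : (planeKGraph K).Adj a b) :
    (planeKGraph K).Adj (similK x u p a) (similK x u p b) := by
  change ‖simil x u p a - simil x u p b‖ = 1
  rw [norm_simil_sub hu]; exact h

/-- THE AVERAGING LEMMA FOR THE PLANE OVER `K`: a geometric-fractional dual certificate on `n` points of `K²` (complex model) together with a Følner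
datum of `N` `K`-rational direct isometries (data `x i, u i, q i ∈ pointsK K`, `‖u i‖ = 1`) and the margin excludes `k`-colourings of the unit-distance
graph of `K²`.  Hypotheses as in `not_colorable_of_geometric_certificate` with `Φ i = similK (x i) (u i) (q i)`. -/
theorem not_colorable_plane_of_geometric_certificate {k n m N e : ℕ}
    (pt : Fin n → pointsK K) (x u q : Fin N → pointsK K) (hu : ∀ i, ‖(u i : ℂ)‖ = 1)
    (y : Fin n → ℚ) (μ : ℚ) (shape : Fin m → Finset (Fin n)) (hne : ∀ t, (shape t).Nonempty) (z : Fin m → ℚ)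
    (rep : Fin m → Fin m)
    (hdual : ∀ S : Finset (Fin n), (∀ a ∈ S, ∀ b ∈ S, ¬ (planeKGraph K).Adj (pt a) (pt b)) →
        ∑ v ∈ S, y v + ∑ t ∈ univ.filter (fun t => shape t ⊆ S), z t ≤ μ)
    (hbal : ∀ r : Fin m, ∑ t ∈ univ.filter (fun t => rep t = r), z t = 0)
    (σ : Fin m → Fin N → Fin N) (E : Fin m → Finset (Fin N)) (hE : ∀ t, (E t).card ≤ e)
    (hσ : ∀ t, Set.InjOn (σ t) {i | i ∉ E t})
    (htrans : ∀ t i, i ∉ E t →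
        (shape t).image (fun v => similK (x i) (u i) (q i) (pt v)) =
          (shape (rep t)).image (fun v => similK (x (σ t i)) (u (σ t i)) (q (σ t i)) (pt v)))
    (hmargin : (e : ℚ) * ∑ t, |z t| < (N : ℚ) * (∑ v, y v - (k : ℚ) * μ)) :
    ¬ (planeUnitDistanceGraph.induce (fieldPoints K)).Colorable k := by
  classical
  intro hcol
  have hK : (planeKGraph K).Colorable k := hcol.of_hom (planeKHom K)
  exact not_colorable_of_geometric_certificate (H := planeKGraph K) pt (fun i => similK (x i) (u i) (q i))
    (fun i _ _ h => similK_adj (hu i) h) y μ shape hne z rep hdual hbal σ E hE hσ htrans hmargin hK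

end Summit.Ventures.DiscreteObjects.UnitDistance
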